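import Summits.QuantumFields.YangMills.Theorems.BalabanUVNodesN18BetaOfRecordBoxDegeneracy
import Summits.QuantumFields.YangMills.Theorems.BalabanUVNodesN18U3GuardsAtKernelsAx

/-!
# BalabanUVNodes ∕ node N18 = NE5 — «β₁₃ BOXWISE CONSTANT ON THE WINDOW» AT THE RECORD, RE-ISSUED GENERIC IN THE β-SLOT χ («Chi») WITH THE RE-CENTRED («Ax»)
# INSTANCE, PIN FORMS READING-FREE: §3–§3b of `Thm/BalabanUVNodesN18BetaOfRecordBoxDegeneracy` (dag-n18-w2, p596517) over `betaOfRecord₁₃Chi θ χ` ∕ `betaOfRecord₁₃Ax θ` and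
# the χ-generic kernel objects `objectsOfRecord₁₃Chi` ∕ `objectsOfRecord₁₃Ax` (`Node00/U3OfKernelsChi`, dag-n16-e g30, p802930) — op 5c K3ᴬ supply row R15

Cell `pub-ymgap`, seat `pub-ymgap-dag-n15-a` g38 (dag-lead WORDS 591∕592∕595 HANDS-4a row R15; plan g99 `OP5C-SUPPLY-CENSUS-K3v8.md` §2 row 15 + σ5; LOCATED by
dag-n16-e g30, pub-ymgap INBOX l.21817).  `--supports stmt-QuantumFields-27247` (K3ᴬ `SpineGivenEndpointR13SepCoPHVAx`) AS A HELPER — count-neutral; PROOF lane (0 `def`).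
NEW basename beside the untouched parent (body-freeze; [Ax-3c]∕[Ax-3d] pattern).

THE POINT.  The parent decided (NO ∕ NOT FORCED) whether the displayed rows force `¬ BoxwiseConstant θ.γ (betaOfRecord₁₃ …)` and typed the exact reading of that predicate and
of the K3 conclusion shape under the node-U3 pin; its §3∕§3b read the CHOICE-centred β `betaOfRecord₁₃ θ` and W1-19's `objectsOfRecord₁₃`.  The K3ᴬ skeleton (v8) displays
`betaOfRecord₁₃Ax` (probe rows `sensitive_rrOfRecord_of_pinned_of_anchor`, `betaOfRecord₁₃Ax … k' v = b k'`) and pins node U3's objects to `objectsOfRecord₁₃Ax` (plan g99 σ5).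
This file is the parent's §3∕§3b with `betaOfRecord₁₃ ↦ betaOfRecord₁₃Chi θ χ`, `chiβOfRecord₁₃ θ ↦ χ`, `objectsOfRecord₁₃ ↦ objectsOfRecord₁₃Chi θ χ` (θ-level, any χ), the
§3b pin forms made READING-FREE (any `X : U3Objects₁₁` with `hX : X = objectsOfRecord₁₃Chi θ χ ℓ`, via row R14's `Thm/BalabanUVNodesN18U3GuardsAtKernelsAx` §2P — so the K3ᴬ v8
rows follow by ONE term at `hX := hpin F θ hP g₀ os` whatever the skeleton's reading type; the `RateReading₁₃CoPHCmap`-typed one-liners follow T1 in a separate module), and the Ax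
instances (`betaOfRecord₁₃Chi θ (chiβOfRecord₁₃Ax θ)` IS `betaOfRecord₁₃Ax θ`).  The parent's §1∕§2 (`constHBeta`, `oneLoopSplitConst`, `RemainderNonvanishingOnBoxes`, `not_boxwiseConstant_iff_remainderNonvanishingOnBoxes`,
`boxwiseConstant_iff_eq_anchor_on_boxes`, …) and `rho8_ne_zero_of_admissible₁₃` are χ-FREE and are USED BY NAME, not re-declared.  Every proof is the parent's, one token changed.

WHAT IS PROVED.
* §3χ at `betaOfRecord₁₃Chi F N θ χ`: `betaOfRecord₁₃Chi_of_mem_box` (on the box it IS the merged β at χ), ★ `boxwiseConstant_betaOfRecord₁₃Chi_iff_secondMoment` (the exact content: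
  history-independence of the (1.22) second moments of the (1.21) limiting kernels of the merged term read through χ), `boxwiseConstant_betaOfRecord₁₃Chi_of_termFamily_blind`,
  ★★ `not_boxwiseConstant_betaOfRecord₁₃Chi_iff_of_scaleAnchor` ∕ `boxwiseConstant_betaOfRecord₁₃Chi_iff_eq_anchor_of_scaleAnchor` (under an anchor: non-degeneracy = the
  missing two-loop letter `RemainderNonvanishingOnBoxes`); §3A the same five at `betaOfRecord₁₃Ax`.
* §3P PIN FORMS, reading-free (`X : U3Objects₁₁`, `hX : X = objectsOfRecord₁₃Chi F N θ χ ℓ`): ★★ `sensitiveOnBoxes_u3OfRecord₁₃_of_eq_objectsOfRecord₁₃Chi_of_remainderNonvanishing`,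
  `betaOfRecord₁₃Chi_eq_anchor_of_blind_of_eq_objectsOfRecord₁₃Chi`; the Ax instances `sensitiveOnBoxes_u3OfRecord₁₃_of_eq_objectsOfRecord₁₃Ax_of_remainderNonvanishing`,
  `betaOfRecord₁₃Ax_eq_anchor_of_blind_of_eq_objectsOfRecord₁₃Ax` (the K3ᴬ v8 probe's l.607–610 ∕ 720–722 conclusions).

A6 (№189) — SATISFIABILITY.  As in the parent: the anchor `hA` ∕ the letter `hnv` ∕ the pin `hpin` are K2's ∕ NODE O's ∕ K3's displayed hypotheses, inhabited by nothing here
(LOCATED); `ScaleAnchor β b ∧ RemainderNonvanishingOnBoxes γ β b` is jointly inhabited in the parent (`exists_anchor_and_remainderNonvanishingOnBoxes`).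

HONEST FRAMING.  Count-neutral helper: kernel bookkeeping re-issued in χ; NOTHING of Bałaban's is asserted; `¬ BoxwiseConstant θ.γ (betaOfRecord₁₃Ax …)` is NEITHER proved NOR refuted
(not decidable from the displayed rows; unprinted, two-loop type); NE5 ∕ (D4) NOT PRINTED for d = 4 ∕ NOT proved; N18 NOT discharged; K3ᴬ OPEN, not claimed; counts UNMOVED (typed
28∕28 · discharged 8∕27 (A 8∕28)).  One finite four-torus programme at fixed `ε`; R4 closes the conditional finite-𝕋⁴ rung `BalabanLadder.UV` only — NOT ℝ⁴, NOT infinite volume,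
NOT OS, NOT a mass gap, NOT Clay.  No `def`, no `sorry`, no `instance`, no `notation`, no `structure`.
-/

set_option autoImplicit false

noncomputable section

namespace YMDAG.N18.BetaBoxDegeneracy

open scoped Matrix.Norms.L2Operator
open Literature.MathematicalPhysics.QuantumFieldTheory.Balaban1983to89
open Literature.MathematicalPhysics.QuantumFieldTheory.Balaban1983to89.T4Continuum (T4Family ULoop)
open Literature.MathematicalPhysics.QuantumFieldTheory.Balaban1983to89.FlowStep (Box HBeta mem_box)
open Literature.MathematicalPhysics.QuantumFieldTheory.Balaban1983to89.B12Beta (HistBox secondMoment)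
open Literature.MathematicalPhysics.QuantumFieldTheory.Balaban1983to89.Node00 (Stage13Params Stage13HParams ChiSlot U3Letters₁₁ U3Objects₁₁ betaOfRecord₁₃Chi betaOfRecord₁₃Ax
  chiβOfRecord₁₃Ax betaMerged betaOfMerged TβOfRecord₁₃ mergedTermFamilyMatT polLimit betaOfMerged_of_mem)
open Literature.MathematicalPhysics.QuantumFieldTheory.Balaban1983to89.Node00.U3OfKernels (objectsOfRecord₁₃Chi objectsOfRecord₁₃Ax)
open YMDAG.UVSplit
open YMDAG.N18.U3Guards (BoxwiseConstant BlindOnBoxes SensitiveOnBoxes)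
open YMDAG.N18.U3GuardsAtKernels (sensitiveOnBoxes_u3OfRecord₁₃_of_eq_objectsOfRecord₁₃Chi' boxwiseConstant_betaOfRecord₁₃Chi_of_blind_of_eq_objectsOfRecord₁₃Chi)

/-! ## §3χ At the Stage-13 record, β-slot χ -/

section RecordChi

variable {F : T4Family} {N : ℕ} [NeZero N] (θ : Stage13Params F N) (χ : ChiSlot F N)

/-- **`betaOfRecord₁₃Chi θ χ` ON THE BOX IS THE MERGED β AT χ** (`Node00.betaOfMerged_of_mem`): for `v ∈ ]0, θ.γ]^{k+1}`, `betaOfRecord₁₃Chi F N θ χ k v = betaMerged F 𝓝χ θ.ρ8 θ.bV k v`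
with `𝓝χ = mergedTermFamilyMatT F N (TβOfRecord₁₃ F N) χ θ.εbg` — the (1.22) second moment at directions `(0, 1)` of the (1.21) `limUnder` kernel. [folklore] -/
theorem betaOfRecord₁₃Chi_of_mem_box {k : ℕ} {v : Fin (k + 1) → ℝ} (hv : v ∈ Box θ.γ k) :
    betaOfRecord₁₃Chi F N θ χ k v =
      (letI := θ.instVβ₁; letI := θ.instVβ₂; letI := θ.instιβ
       betaMerged F (mergedTermFamilyMatT F N (TβOfRecord₁₃ F N) χ θ.εbg) θ.ρ8 θ.bV k v) := by
  letI := θ.instVβ₁; letI := θ.instVβ₂; letI := θ.instιβ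
  exact betaOfMerged_of_mem _ _ _ hv

/-- **★ THE EXACT CONTENT OF «`betaOfRecord₁₃Chi θ χ` BOXWISE CONSTANT ON THE WINDOW»**: at every scale, any two histories of one box `]0, θ.γ]^{k+1}` give the SAME (1.22) second
moment of the (1.21) limiting kernel of the merged term read through χ. [folklore] -/
theorem boxwiseConstant_betaOfRecord₁₃Chi_iff_secondMoment :
    BoxwiseConstant θ.γ (betaOfRecord₁₃Chi F N θ χ) ↔
      ∀ (k : ℕ) (v v' : Fin (k + 1) → ℝ), v ∈ Box θ.γ k → v' ∈ Box θ.γ k →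
        (letI := θ.instVβ₁; letI := θ.instVβ₂; letI := θ.instιβ
         secondMoment (polLimit F (k + 1) (fun K => mergedTermFamilyMatT F N (TβOfRecord₁₃ F N) χ θ.εbg k v K) θ.ρ8 θ.bV) 0 1 =
           secondMoment (polLimit F (k + 1) (fun K => mergedTermFamilyMatT F N (TβOfRecord₁₃ F N) χ θ.εbg k v' K) θ.ρ8 θ.bV) 0 1) := by
  letI := θ.instVβ₁; letI := θ.instVβ₂; letI := θ.instιβ
  constructor
  · intro h k v v' hv hv'
    have h' := h k v v' hv hv'
    rwa [betaOfRecord₁₃Chi_of_mem_box θ χ hv, betaOfRecord₁₃Chi_of_mem_box θ χ hv'] at h'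
  · intro h k v v' hv hv'
    rw [betaOfRecord₁₃Chi_of_mem_box θ χ hv, betaOfRecord₁₃Chi_of_mem_box θ χ hv']
    exact h k v v' hv hv'

/-- **A TERM FAMILY BLIND TO THE BOX HISTORIES GIVES A BOXWISE-CONSTANT `betaOfRecord₁₃Chi θ χ`** (sufficient condition for degeneracy, kernel). [folklore] -/
theorem boxwiseConstant_betaOfRecord₁₃Chi_of_termFamily_blind
    (h : ∀ (k : ℕ) (v v' : Fin (k + 1) → ℝ), v ∈ Box θ.γ k → v' ∈ Box θ.γ k → ∀ K : ℕ,
      mergedTermFamilyMatT F N (TβOfRecord₁₃ F N) χ θ.εbg k v K = mergedTermFamilyMatT F N (TβOfRecord₁₃ F N) χ θ.εbg k v' K) :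
    BoxwiseConstant θ.γ (betaOfRecord₁₃Chi F N θ χ) := by
  rw [boxwiseConstant_betaOfRecord₁₃Chi_iff_secondMoment]
  intro k v v' hv hv'
  rw [show (fun K => mergedTermFamilyMatT F N (TβOfRecord₁₃ F N) χ θ.εbg k v K) = fun K => mergedTermFamilyMatT F N (TβOfRecord₁₃ F N) χ θ.εbg k v' K from
      funext (h k v v' hv hv')]

/-- **★★ UNDER AN ANCHOR OF `betaOfRecord₁₃Chi θ χ`, NON-DEGENERACY IS THE MISSING LETTER** (parent §2 at `β := betaOfRecord₁₃Chi F N θ χ`). [folklore] -/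
theorem not_boxwiseConstant_betaOfRecord₁₃Chi_iff_of_scaleAnchor {b : ℕ → ℝ}
    (hA : ∀ (k : ℕ) (δ : ℝ), 0 < δ → ∃ γ' : ℝ, 0 < γ' ∧ ∀ p : Fin (k + 1) → ℝ, p ∈ HistBox γ' k → |betaOfRecord₁₃Chi F N θ χ k p - b k| ≤ δ) :
    ¬ BoxwiseConstant θ.γ (betaOfRecord₁₃Chi F N θ χ) ↔ RemainderNonvanishingOnBoxes θ.γ (betaOfRecord₁₃Chi F N θ χ) b :=
  not_boxwiseConstant_iff_remainderNonvanishingOnBoxes hA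

/-- **… AND DEGENERACY MEANS «`betaOfRecord₁₃Chi θ χ` IS ITS ONE-LOOP TRUNCATION ON THE WINDOW»**: `β k v = b k` for every `v ∈ ]0, θ.γ]^{k+1}`, every `k`. [folklore] -/
theorem boxwiseConstant_betaOfRecord₁₃Chi_iff_eq_anchor_of_scaleAnchor {b : ℕ → ℝ}
    (hA : ∀ (k : ℕ) (δ : ℝ), 0 < δ → ∃ γ' : ℝ, 0 < γ' ∧ ∀ p : Fin (k + 1) → ℝ, p ∈ HistBox γ' k → |betaOfRecord₁₃Chi F N θ χ k p - b k| ≤ δ) :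
    BoxwiseConstant θ.γ (betaOfRecord₁₃Chi F N θ χ) ↔ ∀ (k : ℕ) (v : Fin (k + 1) → ℝ), v ∈ Box θ.γ k → betaOfRecord₁₃Chi F N θ χ k v = b k :=
  boxwiseConstant_iff_eq_anchor_on_boxes hA

end RecordChi

/-! ## §3A At the RE-CENTRED record: `betaOfRecord₁₃Ax θ` (= `betaOfRecord₁₃Chi θ (chiβOfRecord₁₃Ax θ)`, both `abbrev`s) -/

section RecordAx

variable {F : T4Family} {N : ℕ} [NeZero N] (θ : Stage13Params F N)

/-- **`betaOfRecord₁₃Ax` ON THE BOX IS THE MERGED β AT THE RE-CENTRED CUT-OFF** (§3χ at `χ := chiβOfRecord₁₃Ax θ`). [folklore] -/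
theorem betaOfRecord₁₃Ax_of_mem_box {k : ℕ} {v : Fin (k + 1) → ℝ} (hv : v ∈ Box θ.γ k) :
    betaOfRecord₁₃Ax F N θ k v =
      (letI := θ.instVβ₁; letI := θ.instVβ₂; letI := θ.instιβ
       betaMerged F (mergedTermFamilyMatT F N (TβOfRecord₁₃ F N) (chiβOfRecord₁₃Ax F N θ) θ.εbg) θ.ρ8 θ.bV k v) :=
  betaOfRecord₁₃Chi_of_mem_box θ (chiβOfRecord₁₃Ax F N θ) hv

/-- **★ THE EXACT CONTENT OF «`betaOfRecord₁₃Ax` BOXWISE CONSTANT ON THE WINDOW»** (§3χ at `χ := chiβOfRecord₁₃Ax θ`). [folklore] -/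
theorem boxwiseConstant_betaOfRecord₁₃Ax_iff_secondMoment :
    BoxwiseConstant θ.γ (betaOfRecord₁₃Ax F N θ) ↔
      ∀ (k : ℕ) (v v' : Fin (k + 1) → ℝ), v ∈ Box θ.γ k → v' ∈ Box θ.γ k →
        (letI := θ.instVβ₁; letI := θ.instVβ₂; letI := θ.instιβ
         secondMoment (polLimit F (k + 1) (fun K => mergedTermFamilyMatT F N (TβOfRecord₁₃ F N) (chiβOfRecord₁₃Ax F N θ) θ.εbg k v K) θ.ρ8 θ.bV) 0 1 =
           secondMoment (polLimit F (k + 1) (fun K => mergedTermFamilyMatT F N (TβOfRecord₁₃ F N) (chiβOfRecord₁₃Ax F N θ) θ.εbg k v' K) θ.ρ8 θ.bV) 0 1) :=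
  boxwiseConstant_betaOfRecord₁₃Chi_iff_secondMoment θ (chiβOfRecord₁₃Ax F N θ)

/-- **A TERM FAMILY BLIND TO THE BOX HISTORIES GIVES A BOXWISE-CONSTANT `betaOfRecord₁₃Ax`** (§3χ at `χ := chiβOfRecord₁₃Ax θ`). [folklore] -/
theorem boxwiseConstant_betaOfRecord₁₃Ax_of_termFamily_blind
    (h : ∀ (k : ℕ) (v v' : Fin (k + 1) → ℝ), v ∈ Box θ.γ k → v' ∈ Box θ.γ k → ∀ K : ℕ,
      mergedTermFamilyMatT F N (TβOfRecord₁₃ F N) (chiβOfRecord₁₃Ax F N θ) θ.εbg k v K = mergedTermFamilyMatT F N (TβOfRecord₁₃ F N) (chiβOfRecord₁₃Ax F N θ) θ.εbg k v' K) :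
    BoxwiseConstant θ.γ (betaOfRecord₁₃Ax F N θ) :=
  boxwiseConstant_betaOfRecord₁₃Chi_of_termFamily_blind θ (chiβOfRecord₁₃Ax F N θ) h

/-- **★★ UNDER AN ANCHOR OF `betaOfRecord₁₃Ax`, NON-DEGENERACY IS THE MISSING LETTER** (§3χ at `χ := chiβOfRecord₁₃Ax θ`). [folklore] -/
theorem not_boxwiseConstant_betaOfRecord₁₃Ax_iff_of_scaleAnchor {b : ℕ → ℝ}
    (hA : ∀ (k : ℕ) (δ : ℝ), 0 < δ → ∃ γ' : ℝ, 0 < γ' ∧ ∀ p : Fin (k + 1) → ℝ, p ∈ HistBox γ' k → |betaOfRecord₁₃Ax F N θ k p - b k| ≤ δ) :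
    ¬ BoxwiseConstant θ.γ (betaOfRecord₁₃Ax F N θ) ↔ RemainderNonvanishingOnBoxes θ.γ (betaOfRecord₁₃Ax F N θ) b :=
  not_boxwiseConstant_betaOfRecord₁₃Chi_iff_of_scaleAnchor θ (chiβOfRecord₁₃Ax F N θ) hA

/-- **… AND DEGENERACY MEANS «`betaOfRecord₁₃Ax` IS ITS ONE-LOOP TRUNCATION ON THE WINDOW»** (§3χ at `χ := chiβOfRecord₁₃Ax θ`). [folklore] -/
theorem boxwiseConstant_betaOfRecord₁₃Ax_iff_eq_anchor_of_scaleAnchor {b : ℕ → ℝ}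
    (hA : ∀ (k : ℕ) (δ : ℝ), 0 < δ → ∃ γ' : ℝ, 0 < γ' ∧ ∀ p : Fin (k + 1) → ℝ, p ∈ HistBox γ' k → |betaOfRecord₁₃Ax F N θ k p - b k| ≤ δ) :
    BoxwiseConstant θ.γ (betaOfRecord₁₃Ax F N θ) ↔ ∀ (k : ℕ) (v : Fin (k + 1) → ℝ), v ∈ Box θ.γ k → betaOfRecord₁₃Ax F N θ k v = b k :=
  boxwiseConstant_betaOfRecord₁₃Chi_iff_eq_anchor_of_scaleAnchor θ (chiβOfRecord₁₃Ax F N θ) hA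

end RecordAx

/-! ## §3P The K3ᴬ conclusion shape under the node-U3 pin, READING-FREE (row R14's §2P: any `X : U3Objects₁₁` equal to the χ-generic ∕ re-centred kernel objects) -/

section PinnedFree

variable {F : T4Family} {N : ℕ} [NeZero N] (θ : Stage13Params F N) (χ : ChiSlot F N) (ℓ : U3Letters₁₁) {X : U3Objects₁₁}

/-- **★★ `KeyedSensitive`'s CONCLUSION AT A TUPLE, FROM THE ANCHOR + THE MISSING LETTER** (χ-generic, reading-free): for a node-U3 object pinned to `objectsOfRecord₁₃Chi θ χ ℓ`, if
`betaOfRecord₁₃Chi θ χ` is anchored at `b` and its remainder relative to `b` does not vanish identically on the window, EVERY run-length bundle passes the node-U3 guard (row R14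
`sensitiveOnBoxes_u3OfRecord₁₃_of_eq_objectsOfRecord₁₃Chi'` + parent §2 `not_boxwiseConstant_of_scaleAnchor`). [folklore] -/
theorem sensitiveOnBoxes_u3OfRecord₁₃_of_eq_objectsOfRecord₁₃Chi_of_remainderNonvanishing (hX : X = objectsOfRecord₁₃Chi F N θ χ ℓ) {b : ℕ → ℝ}
    (hA : ∀ (k : ℕ) (δ : ℝ), 0 < δ → ∃ γ' : ℝ, 0 < γ' ∧ ∀ p : Fin (k + 1) → ℝ, p ∈ HistBox γ' k → |betaOfRecord₁₃Chi F N θ χ k p - b k| ≤ δ)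
    (hnv : RemainderNonvanishingOnBoxes θ.γ (betaOfRecord₁₃Chi F N θ χ) b) (k : ℕ) :
    SensitiveOnBoxes (u3OfRecord₁₃ θ X k).EA θ.γ :=
  sensitiveOnBoxes_u3OfRecord₁₃_of_eq_objectsOfRecord₁₃Chi' θ χ ℓ hX (not_boxwiseConstant_of_scaleAnchor hA hnv) k

/-- **THE FAILURE MODE UNDER THE PIN, READ THROUGH THE ANCHOR** (χ-generic, reading-free): a pinned object with a BLIND run-length bundle forces `betaOfRecord₁₃Chi θ χ k' v = b k'`
on every box (row R14 `boxwiseConstant_betaOfRecord₁₃Chi_of_blind_of_eq_objectsOfRecord₁₃Chi` + parent §2). [folklore] -/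
theorem betaOfRecord₁₃Chi_eq_anchor_of_blind_of_eq_objectsOfRecord₁₃Chi (hX : X = objectsOfRecord₁₃Chi F N θ χ ℓ) {b : ℕ → ℝ}
    (hA : ∀ (k : ℕ) (δ : ℝ), 0 < δ → ∃ γ' : ℝ, 0 < γ' ∧ ∀ p : Fin (k + 1) → ℝ, p ∈ HistBox γ' k → |betaOfRecord₁₃Chi F N θ χ k p - b k| ≤ δ)
    (k : ℕ) (h : BlindOnBoxes (u3OfRecord₁₃ θ X k).EA θ.γ) (k' : ℕ) (v : Fin (k' + 1) → ℝ) (hv : v ∈ Box θ.γ k') : betaOfRecord₁₃Chi F N θ χ k' v = b k' :=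
  (boxwiseConstant_iff_eq_anchor_on_boxes hA).mp (boxwiseConstant_betaOfRecord₁₃Chi_of_blind_of_eq_objectsOfRecord₁₃Chi θ χ ℓ hX k h) k' v hv

/-- **★★ AT THE RE-CENTRED RECORD (reading-free): `KeyedSensitive`'s conclusion from the anchor + the missing letter for `betaOfRecord₁₃Ax`** — the K3ᴬ v8 row
`sensitive_rrOfRecord_of_pinned_of_anchor` under `U3PinnedKernels` (σ5: pin at `objectsOfRecord₁₃Ax`), by ONE term at `hX := hpin F θ hP g₀ os`. [folklore] -/
theorem sensitiveOnBoxes_u3OfRecord₁₃_of_eq_objectsOfRecord₁₃Ax_of_remainderNonvanishing (hX : X = objectsOfRecord₁₃Ax F N θ ℓ) {b : ℕ → ℝ}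
    (hA : ∀ (k : ℕ) (δ : ℝ), 0 < δ → ∃ γ' : ℝ, 0 < γ' ∧ ∀ p : Fin (k + 1) → ℝ, p ∈ HistBox γ' k → |betaOfRecord₁₃Ax F N θ k p - b k| ≤ δ)
    (hnv : RemainderNonvanishingOnBoxes θ.γ (betaOfRecord₁₃Ax F N θ) b) (k : ℕ) :
    SensitiveOnBoxes (u3OfRecord₁₃ θ X k).EA θ.γ :=
  sensitiveOnBoxes_u3OfRecord₁₃_of_eq_objectsOfRecord₁₃Chi_of_remainderNonvanishing θ (chiβOfRecord₁₃Ax F N θ) ℓ hX hA hnv k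

/-- **AT THE RE-CENTRED RECORD (reading-free): the failure mode under the pin, read through the anchor** — a BLIND run-length bundle forces `betaOfRecord₁₃Ax … k' v = b k'` on
every box; the K3ᴬ v8 row at probe l.720–722, by ONE term. [folklore] -/
theorem betaOfRecord₁₃Ax_eq_anchor_of_blind_of_eq_objectsOfRecord₁₃Ax (hX : X = objectsOfRecord₁₃Ax F N θ ℓ) {b : ℕ → ℝ}
    (hA : ∀ (k : ℕ) (δ : ℝ), 0 < δ → ∃ γ' : ℝ, 0 < γ' ∧ ∀ p : Fin (k + 1) → ℝ, p ∈ HistBox γ' k → |betaOfRecord₁₃Ax F N θ k p - b k| ≤ δ)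
    (k : ℕ) (h : BlindOnBoxes (u3OfRecord₁₃ θ X k).EA θ.γ) (k' : ℕ) (v : Fin (k' + 1) → ℝ) (hv : v ∈ Box θ.γ k') : betaOfRecord₁₃Ax F N θ k' v = b k' :=
  betaOfRecord₁₃Chi_eq_anchor_of_blind_of_eq_objectsOfRecord₁₃Chi θ (chiβOfRecord₁₃Ax F N θ) ℓ hX hA k h k' v hv

end PinnedFree

end YMDAG.N18.BetaBoxDegeneracy

end
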